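import Mathlib
import Literature.Barriers.ValiantsHypothesis.AlgebraicNaturalProofs
import Literature.Computability.AlgebraicComplexity.ArithCircuitProofs
import Summits.ValiantsHypothesis.ValiantsHypothesis.Theorems.BarrierLeverSuccinctHittingSetsForVPStubSeparableCoeff
import Summits.ValiantsHypothesis.ValiantsHypothesis.Theorems.BarrierLeverSuccinctHittingSetsForVPGenerator
import HarnessLib

/-!
# Crux `BarrierLever.SuccinctHittingSetsForVP` (stmt-ValiantsHypothesis-14610), line `registered` —
stub `stub_sps2Hit`: `ΣΠΣ(2)` DISTINGUISHERS ARE HIT BY `SmallCircuits ℂ n 9` (wave 7 glue)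

**What is proved (conditional on the statement of the neighbour stub `stub_sps2NotAnnihilated`, taken
verbatim as the first hypothesis; it does NOT close the item).** In FSV's framework over `ℂ` (tree
regime `d = n`, coefficient variables indexed by `degLEMonomials n`, simple class
`SmallCircuits ℂ n b = {f : deg f ≤ n, L(f) ≤ n^b}`):

* `stub_sps2Hit` : IF no nonzero `ΣΠΣ(2)` distinguisher `D = a ∏_i ℓ_i + b ∏_j ℓ'_j` (`ℓ_i, ℓ'_j` of
  total degree `1`) annihilates the two-seed separable generator
  `Γ₂ μ = Σ_{r < 2} y_r ∏_i s_{r,i}^{μ_i}` (seed variables `Fin 2 ⊕ (Fin 2 × Fin n)`), THEN for every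
  `n ≥ 8` the coefficient vectors of `SmallCircuits ℂ n 9` hit every nonzero such `D`.

**Proof.** The generator principle `Generator.exists_mem_smallCircuits_of_aeval_ne_zero` (what a
realisable map does not annihilate is hit) reduces the claim to the REALISABILITY of `Γ₂` inside
`coeff(SmallCircuits ℂ n 9)`: at a seed point `pt = (y, s)` the value `Γ₂(pt)` is the coefficient
vector of `f = Σ_{r < 2} y_r Λ_r`, where `Λ_r ∈ SmallCircuits ℂ n 8` is the circuit of
`stub_separableCoeff` for the rank-one table `c_i(j) = s_{r,i}^j` (so `coeff_μ Λ_r = ∏_i s_{r,i}^{μ_i}`);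
`deg f ≤ n` and `L(f) ≤ 2 (n^8 + 1) + 2 ≤ n^9` for `n ≥ 8` (Bürgisser's size lemmas
`complexity_add_le` / `complexity_mul_le` / `complexity_C`). Axioms: `propext`, `Classical.choice`,
`Quot.sound`.

References: [ForbesShpilkaVolk2018] §3 (generators, Lemma 3.4), Construction 25 (succinctness of
products of univariates); [Burgisser2000] Def. 2.1, §2.1 (the complexity measure).
-/

-- layout Summits/ValiantsHypothesis/ValiantsHypothesis forces the duplicated namespace component
set_option linter.dupNamespace false

namespace Summit.ValiantsHypothesis.ValiantsHypothesis.Theorems.BarrierLever.SuccinctHittingSetsForVP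

open Literature.Barriers.ValiantsHypothesis Literature.Computability.AlgebraicComplexity MvPolynomial

namespace Sps2Hit

variable {n : ℕ}

/-- The size budget of the two-seed realisation: for `n ≥ 8`, `2 (n^8 + 1) + 2 ≤ n^9`. [folklore] -/
theorem size_budget (hn : 8 ≤ n) : (∑ _r : Fin 2, (n ^ 8 + 1)) + 2 ≤ n ^ 9 := by
  rw [Finset.sum_const, Finset.card_univ, Fintype.card_fin, smul_eq_mul]
  have h8 : 1 ≤ n ^ 8 := Nat.one_le_pow _ _ (by omega)
  calc 2 * (n ^ 8 + 1) + 2 ≤ 6 * n ^ 8 := by linarith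
    _ ≤ n * n ^ 8 := Nat.mul_le_mul_right _ (by omega)
    _ = n ^ 9 := by ring

/-- **Realisability of the two-seed generator (size and degree).** If `Λ_r ∈ SmallCircuits ℂ n 8`
(`r < 2`) and `n ≥ 8`, then `Σ_r c_r Λ_r ∈ SmallCircuits ℂ n 9`.
[cite: ForbesShpilkaVolk2018, Construction 25] -/
theorem sum_mem_smallCircuits (hn : 8 ≤ n) {Λ : Fin 2 → MvPolynomial (Fin n) ℂ}
    (hΛ : ∀ r, Λ r ∈ SmallCircuits ℂ n 8) (c : Fin 2 → ℂ) :
    ∑ r : Fin 2, C (c r) * Λ r ∈ SmallCircuits ℂ n 9 := by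
  refine ⟨totalDegree_finsetSum_le fun r _ => ?_, ?_⟩
  · calc (C (c r) * Λ r).totalDegree ≤ (C (c r) : MvPolynomial (Fin n) ℂ).totalDegree +
          (Λ r).totalDegree := totalDegree_mul _ _
      _ ≤ n := by rw [totalDegree_C, zero_add]; exact (hΛ r).1
  · calc complexity (∑ r : Fin 2, C (c r) * Λ r)
        ≤ ∑ r : Fin 2, complexity (C (c r) * Λ r) + (Finset.univ : Finset (Fin 2)).card :=
          complexity_finset_sum_le _ _
      _ ≤ (∑ _r : Fin 2, (n ^ 8 + 1)) + 2 := by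
          gcongr with r _
          · calc complexity (C (c r) * Λ r)
                ≤ complexity (C (c r) : MvPolynomial (Fin n) ℂ) + complexity (Λ r) + 1 :=
                  complexity_mul_le_holds _ _
              _ ≤ 0 + n ^ 8 + 1 := by
                  rw [complexity_C_holds]
                  gcongr
                  exact (hΛ r).2
              _ = n ^ 8 + 1 := by ring
          · rw [Finset.card_univ, Fintype.card_fin]
      _ ≤ n ^ 9 := size_budget hn

/-- **Realisability of the two-seed generator (coefficients).** The coefficient vector of
`Σ_r c_r Λ_r` is `Σ_r c_r coeff Λ_r`. [folklore] -/
theorem coeff_sum_C_mul (Λ : Fin 2 → MvPolynomial (Fin n) ℂ) (c : Fin 2 → ℂ) (m : Fin n →₀ ℕ) :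
    coeff m (∑ r : Fin 2, C (c r) * Λ r) = ∑ r : Fin 2, c r * coeff m (Λ r) := by
  rw [coeff_sum]
  simp only [coeff_C_mul]

/-- Evaluating one coordinate of the two-seed separable generator
`Γ₂ μ = Σ_{r < 2} y_r ∏_i s_{r,i}^{μ_i}` at a seed point `pt = (y, s)`. [folklore] -/
theorem eval_generator₂ (pt : Fin 2 ⊕ (Fin 2 × Fin n) → ℂ) (μ : degLEMonomials n) :
    eval pt (∑ r : Fin 2, (X (Sum.inl r) : MvPolynomial (Fin 2 ⊕ (Fin 2 × Fin n)) ℂ) *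
        ∏ i : Fin n, X (Sum.inr (r, i)) ^ (μ : Fin n →₀ ℕ) i) =
      ∑ r : Fin 2, pt (Sum.inl r) * ∏ i : Fin n, pt (Sum.inr (r, i)) ^ (μ : Fin n →₀ ℕ) i := by
  simp only [map_sum, map_mul, map_prod, map_pow, eval_X]

/-- **Realisability of the two-seed separable generator in `SmallCircuits ℂ n 9` (`n ≥ 8`).** Every
value `Γ₂(pt)` is the coefficient vector of some `f ∈ SmallCircuits ℂ n 9`, namely
`f = Σ_r y_r Λ_r` with `Λ_r` the circuit of `stub_separableCoeff` for the table `c_i(j) = s_{r,i}^j`.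
[cite: ForbesShpilkaVolk2018, Construction 25 and §3] -/
theorem realisable (hn : 8 ≤ n) (pt : Fin 2 ⊕ (Fin 2 × Fin n) → ℂ) :
    ∃ f ∈ SmallCircuits ℂ n 9, ∀ μ : degLEMonomials n,
      coeff (μ : Fin n →₀ ℕ) f =
        eval pt (∑ r : Fin 2, (X (Sum.inl r) : MvPolynomial (Fin 2 ⊕ (Fin 2 × Fin n)) ℂ) *
          ∏ i : Fin n, X (Sum.inr (r, i)) ^ (μ : Fin n →₀ ℕ) i) := by
  choose Λ hΛmem hΛcoeff using fun r : Fin 2 =>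
    stub_separableCoeff n hn (fun i j => pt (Sum.inr (r, i)) ^ j)
  refine ⟨∑ r : Fin 2, C (pt (Sum.inl r)) * Λ r, sum_mem_smallCircuits hn hΛmem _, fun μ => ?_⟩
  rw [coeff_sum_C_mul, eval_generator₂]
  simp only [hΛcoeff]

end Sps2Hit

/-- **Registered stub `stub_sps2Hit`** (crux stmt-ValiantsHypothesis-14610, line `registered`; wave 7
glue): IF no nonzero `ΣΠΣ(2)` distinguisher `a ∏_i ℓ_i + b ∏_j ℓ'_j` (affine forms `ℓ_i, ℓ'_j` of
total degree `1` in the coefficient variables) annihilates the two-seed separable generator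
`Γ₂ μ = Σ_{r < 2} y_r ∏_i s_{r,i}^{μ_i}`, THEN for every `n ≥ 8` the coefficient vectors of
`SmallCircuits ℂ n 9` hit every nonzero such distinguisher — the generator principle with `Γ₂`
realised by `y₀ Λ₀ + y₁ Λ₁`, `Λ_r ∈ SmallCircuits ℂ n 8` from `stub_separableCoeff`.
[cite: ForbesShpilkaVolk2018, §3 and Construction 25] -/
theorem stub_sps2Hit :
    (∀ (n p q : ℕ) (a b : ℂ) (ℓ : Fin p → MvPolynomial (degLEMonomials n) ℂ)
      (ℓ' : Fin q → MvPolynomial (degLEMonomials n) ℂ),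
      (∀ i, (ℓ i).totalDegree = 1) → (∀ j, (ℓ' j).totalDegree = 1) →
      C a * ∏ i, ℓ i + C b * ∏ j, ℓ' j ≠ 0 →
      MvPolynomial.aeval
        (fun μ : degLEMonomials n => ∑ r : Fin 2,
            (X (Sum.inl r) : MvPolynomial (Fin 2 ⊕ (Fin 2 × Fin n)) ℂ) *
              ∏ i : Fin n, X (Sum.inr (r, i)) ^ (μ : Fin n →₀ ℕ) i)
        (C a * ∏ i, ℓ i + C b * ∏ j, ℓ' j) ≠ 0) →
    ∀ n : ℕ, 8 ≤ n →
      IsSuccinctHittingSet (degLEMonomials n) (SmallCircuits ℂ n 9)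
        {D | ∃ (p q : ℕ) (a b : ℂ) (ℓ : Fin p → MvPolynomial (degLEMonomials n) ℂ)
          (ℓ' : Fin q → MvPolynomial (degLEMonomials n) ℂ),
          (∀ i, (ℓ i).totalDegree = 1) ∧ (∀ j, (ℓ' j).totalDegree = 1) ∧
          D = C a * ∏ i, ℓ i + C b * ∏ j, ℓ' j} := by
  intro hyp n hn
  rintro D ⟨p, q, a, b, ℓ, ℓ', hℓ, hℓ', rfl⟩ hD0
  exact Generator.exists_mem_smallCircuits_of_aeval_ne_zero (Sps2Hit.realisable hn)
    (hyp n p q a b ℓ ℓ' hℓ hℓ' hD0)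

end Summit.ValiantsHypothesis.ValiantsHypothesis.Theorems.BarrierLever.SuccinctHittingSetsForVP
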